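import Summits.CriticalPhenomena.PercolationContinuityZ3.Theorems.SoloInformedCrossingLowerBound
import Literature.Probability.Percolation.SiteConnectionTools
import Literature.Probability.RandomPlanarGeometry.SAWCount
import HarnessLib

/-!
# RSW3 lane (P2, method "3D RSW-lite from continuity"): one-step DECOUPLING of the annulus crossing
# `Λ(L) ↔ ∂ⁱⁿΛ(R)` at an intermediate sphere, without the BK inequality (all `p`, all `d`)

builds on p205010 (kernel theorem, internal audit signed; external expert review pending)

Cell `prim-rsw3` (post-continuity programme, LANE 3 "box crossing / quasi-multiplicativity at
`p_c(ℤ³)`"), prover seat `prim-rsw3-p2` (gen 2), memo `run/shared/lean/prim/rsw3/P2-RSWLITE.md` §7.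
Support file (`--supports stmt-CriticalPhenomena-4575`); no definitions, no named facts, no sorries.
Toolbox for `PercNearOneGluingNoHeavyRsw3AnnulusAspectWindow` (the annulus crossing window at every
aspect ratio, `(2d)⁻¹ (L/4N)^{d-1} ≤ u_{p_c}(L,N)`), where `u_p(L,N) = P_p(boxCrossing d L N) =
P_p(Λ(L) ↔ ∂ⁱⁿΛ(N) in Λ(N))`.

* `boxCrossing_subset_biUnion_exit` — **geometric covering**: for `L ≤ N`, `N + 2L + 2 ≤ R`,
  `M = R - (N+L+2)`, an open path from `Λ(L)` to `∂ⁱⁿΛ(R)` inside `Λ(R)` realises `boxCrossing d L N`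
  (an event read on the edges INSIDE `Λ(N)`) and, from its LAST exit point `c` of `Λ(N)`
  (`‖c‖∞ = N+1`, `c` in the grid block `Λ_g(L)`, `g ∈ (2L+1)ℤ^d`) onwards, a crossing from `Λ_g(L)` to
  `∂ⁱⁿΛ_g(M)` inside `Λ_g(M) ∖ Λ(N)` — an event read on the edges OUTSIDE `Λ(N)`; the grid index of `g`
  lies on `∂ⁱⁿΛ(K)`, `K = ⌊(N+1+L)/(2L+1)⌋` (`gridIdx_mem_innerBoundary`), a set of at most
  `2d (2K+1)^{d-1} ≤ 2d (4N/L)^{d-1}` indices (`card_innerBoundary_gridBox_le`).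
* `real_exitPiece_le` — the outer piece has probability `≤ u_p(L, M)` (monotonicity in the region,
  translation invariance `real_linked_image`).
* `real_boxCrossing_le_card_mul` / `real_boxCrossing_le_mul` — **one-step decoupling**:
  `u_p(L, R) ≤ |∂ⁱⁿΛ(K)| · u_p(L,N) · u_p(L, R-(N+L+2)) ≤ 2d (4N/L)^{d-1} · u_p(L,N) · u_p(L, R-(N+L+2))`
  (independence of events determined by disjoint edge sets, `bondPercolation_real_inter_of_disjoint`;
  union bound over the exit blocks).  The count `(N/L)^{d-1}` of exit BLOCKS (rather than `N^{d-1}` exit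
  points) is what makes the resulting lower bound at `p_c` uniform in the inner scale.

Classical (the block-counting step of Kesten's sponge-crossing criterion, Thm. 5.1, in annulus form);
dimension-free.  References: H. Kesten, *Percolation Theory for Mathematicians* (1982), Thm. 5.1;
G. Grimmett, *Percolation* (1999), §1.6, §2 (locality, translation invariance). [folklore]
-/

noncomputable section

namespace Summit.CriticalPhenomena.PercolationContinuityZ3.Theorems

open MeasureTheory ProbabilityTheory Filter Topology
open Literature.Probability.Percolation Literature.Probability.LatticeModels
open Literature.Probability.Percolation.CerfDembinVanishing

namespace Rsw3

open SurfaceTension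

variable {d : ℕ}

/-! ## Small geometric facts -/

/-- A site outside `Λ(N)` adjacent to a site of `Λ(N)` has a coordinate of absolute value `N + 1`,
and all coordinates of absolute value at most `N + 1` (neighbours differ by at most one in every
coordinate, `SAW.Zd.abs_sub_le_one_of_adj`). -/
theorem exists_abs_eq_of_adj_of_notMem_box {N : ℕ} {c c' : Site d} (hc : c ∉ box d N)
    (hc' : c' ∈ box d N) (h : (zdGraph d).Adj c c') :
    (∃ i, |c i| = (N : ℤ) + 1) ∧ c ∈ box d (N + 1) := by
  have hcoord : ∀ j, |c j| ≤ (N : ℤ) + 1 := by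
    intro j
    have h1 := Literature.Probability.RandomPlanarGeometry.SAW.Zd.abs_sub_le_one_of_adj h j
    have h2 := (mem_box.1 hc') j
    rw [abs_le] at h1 ⊢
    constructor <;> linarith [h2.1, h2.2]
  refine ⟨?_, ?_⟩
  · rw [mem_box] at hc
    push Not at hc
    obtain ⟨i, hi⟩ := hc
    refine ⟨i, le_antisymm (hcoord i) ?_⟩
    by_contra hlt
    push Not at hlt
    rw [abs_lt] at hlt
    by_cases hle : -(N : ℤ) ≤ c i
    · have := hi hle; omega
    · omega
  · rw [mem_box]
    intro j
    have := hcoord j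
    rw [abs_le] at this
    exact_mod_cast this

/-! ## The exit blocks: grid indices whose `L`-block meets the sphere `‖x‖∞ = N+1` -/

/-- The grid index of a site `c` with `‖c‖∞ = N+1` lies on the inner boundary of the index box
`Λ(K)`, `K = ⌊(N+1+L)/(2L+1)⌋`. -/
theorem gridIdx_mem_innerBoundary {L N : ℕ} {c : Site d} (hc : c ∈ box d (N + 1))
    (hci : ∃ i, |c i| = (N : ℤ) + 1) :
    gridIdx L c ∈ innerBoundary (zdGraph d) (box d ((N + 1 + L) / (2 * L + 1))) := by
  set K := (N + 1 + L) / (2 * L + 1) with hK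
  have hb : 0 < 2 * L + 1 := by omega
  have hK1 : (N + 1 + L : ℕ) < (K + 1) * (2 * L + 1) := by
    have := Nat.lt_succ_iff.2 (le_refl K)
    rw [hK] at this ⊢
    exact (Nat.div_lt_iff_lt_mul hb).1 (Nat.lt_succ_iff.2 le_rfl)
  have hK2 : K * (2 * L + 1) ≤ N + 1 + L := Nat.div_mul_le_self _ _
  have hkbox : gridIdx L c ∈ box d K :=
    gridIdx_mem_box (M := N + 1) (K := K) (by exact_mod_cast hK1) hc
  obtain ⟨i, hi⟩ := hci
  -- the `i`-th grid coordinate has absolute value exactly `K`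
  have hgi := gridPt_gridIdx_sub_le L c i
  have hki : |gridIdx L c i| = K := by
    have hle : |gridIdx L c i| ≤ K := abs_le.2 ((mem_box.1 hkbox) i)
    refine le_antisymm hle ?_
    by_contra hlt
    push Not at hlt
    -- `(2L+1) |k_i| ≥ |c_i| - L = N + 1 - L`
    have h1 : (N : ℤ) + 1 - L ≤ (2 * (L : ℤ) + 1) * |gridIdx L c i| := by
      have : |c i| - L ≤ |gridPt L (gridIdx L c) i| := by
        have := abs_sub_abs_le_abs_sub (c i) (gridPt L (gridIdx L c) i)
        have habs : |c i - gridPt L (gridIdx L c) i| ≤ L := abs_le.2 hgi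
        linarith
      rw [hi] at this
      simpa [gridPt, abs_mul, abs_of_nonneg (show (0 : ℤ) ≤ 2 * L + 1 by positivity)] using this
    have h2 : (2 * (L : ℤ) + 1) * |gridIdx L c i| ≤ (2 * (L : ℤ) + 1) * (K - 1) :=
      mul_le_mul_of_nonneg_left (by omega) (by positivity)
    have h3 : ((K : ℕ) : ℤ) * (2 * L + 1) ≤ N + 1 + L := by exact_mod_cast hK2
    nlinarith
  rw [mem_innerBoundary_iff]
  refine ⟨hkbox, ?_⟩
  -- a neighbour outside `Λ(K)` in direction `i`
  rcases (abs_eq (by positivity : (0 : ℤ) ≤ K)).1 hki with hpos | hneg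
  · refine ⟨gridIdx L c + Pi.single i 1, ?_, ?_⟩
    · intro hmem
      have := ((mem_box.1 hmem) i).2
      simp [hpos] at this
    · exact (zdGraph_adj_iff _ _).2 ⟨i, Or.inl rfl⟩
  · refine ⟨gridIdx L c - Pi.single i 1, ?_, ?_⟩
    · intro hmem
      have := ((mem_box.1 hmem) i).1
      simp [hneg] at this
    · exact (zdGraph_adj_iff _ _).2 ⟨i, Or.inr (by simp)⟩

/-- The number of exit blocks: `|∂ⁱⁿΛ(K)| ≤ 2d (2K+1)^{d-1} ≤ 2d (4N/L)^{d-1}` for `1 ≤ L ≤ N`. -/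
theorem card_innerBoundary_gridBox_le {L N : ℕ} (hL : 1 ≤ L) (hLN : L ≤ N) :
    ((innerBoundary (zdGraph d) (box d ((N + 1 + L) / (2 * L + 1)))).card : ℝ) ≤
      2 * d * (4 * (N : ℝ) / L) ^ (d - 1) := by
  set K := (N + 1 + L) / (2 * L + 1) with hK
  have hcard := Literature.Probability.Percolation.card_innerBoundary_box_le (d := d) K
  have hK2 : K * (2 * L + 1) ≤ N + 1 + L := Nat.div_mul_le_self _ _
  have hL0 : (0 : ℝ) < L := by exact_mod_cast hL
  -- `2K + 1 ≤ 4N/L`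
  have hKle : (2 * (K : ℝ) + 1) ≤ 4 * (N : ℝ) / L := by
    rw [le_div_iff₀ hL0]
    have h1 : ((K : ℕ) : ℝ) * (2 * L + 1) ≤ N + 1 + L := by exact_mod_cast hK2
    have h2 : (1 : ℝ) ≤ L := by exact_mod_cast hL
    have h3 : (L : ℝ) ≤ N := by exact_mod_cast hLN
    nlinarith
  calc ((innerBoundary (zdGraph d) (box d K)).card : ℝ)
      ≤ 2 * d * (2 * (K : ℝ) + 1) ^ (d - 1) := by exact_mod_cast hcard
    _ ≤ 2 * d * (4 * (N : ℝ) / L) ^ (d - 1) := by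
        gcongr

/-! ## The one-step decoupling -/

/-- `A ↔ B in S` is monotone in the region `S`. -/
theorem linked_mono_region {S S' : Set (Site d)} (h : S ⊆ S') (A B : Set (Site d)) :
    linked S A B ⊆ linked S' A B := by
  intro ω hω
  rw [mem_linked_iff] at hω ⊢
  obtain ⟨a, ha, b, hb, hab⟩ := hω
  exact ⟨a, ha, b, hb, inConn_mono h a b hab⟩

/-- **Geometric covering.** For `L ≤ N`, `N + 2L + 2 ≤ R`, `M = R - (N + L + 2)`: an open crossing
from `Λ(L)` to `∂ⁱⁿΛ(R)` inside `Λ(R)` realises `boxCrossing d L N` and, for the grid block `Λ_g(L)`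
containing its last exit point from `Λ(N)`, a crossing from `Λ_g(L)` to `∂ⁱⁿΛ_g(M)` inside
`Λ_g(M) ∖ Λ(N)`; the grid index of `g` lies in `∂ⁱⁿΛ(K)`, `K = ⌊(N+1+L)/(2L+1)⌋`. -/
theorem boxCrossing_subset_biUnion_exit {L N R : ℕ} (hLN : L ≤ N) (hR : N + 2 * L + 2 ≤ R) :
    boxCrossing d L R ⊆
      ⋃ k ∈ innerBoundary (zdGraph d) (box d ((N + 1 + L) / (2 * L + 1))),
        (boxCrossing d L N ∩
          linked (sbox (gridPt L k) (R - (N + L + 2)) ∩ (↑(box d N))ᶜ)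
            ((zdShiftIso (gridPt L k)) ''
              ↑(innerBoundary (zdGraph d) (box d (R - (N + L + 2)))))
            (sbox (gridPt L k) L)) := by
  intro ω hω
  set M := R - (N + L + 2) with hM
  have hLM : L ≤ M := by omega
  have hNR : N ≤ R := by omega
  -- piece 1 is immediate
  have h1 : ω ∈ boxCrossing d L N := boxCrossing_anti hLN hNR hω
  -- the open path
  rw [boxCrossing_eq_linked, mem_linked_iff] at hω
  obtain ⟨b, hb, a, ha, hab⟩ := hω
  rw [Finset.mem_coe] at ha hb
  obtain ⟨i₀, hi₀⟩ := exists_eq_of_mem_innerBoundary_box hb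
  set H := openGraph ω ⊓ withinGraph (zdGraph d) (↑(box d R) : Set (Site d)) with hHdef
  have hH : H ≤ zdGraph d := inf_le_right.trans (withinGraph_le _ _)
  have hreach : H.Reachable b a := by
    rw [mem_inConn_iff] at hab; exact hab
  obtain ⟨W⟩ := hreach
  -- last exit from `Λ(N)`, seen from `b`
  have hbS : b ∈ (↑(box d N) : Set (Site d))ᶜ := by
    intro hbN
    have := (mem_box.1 (Finset.mem_coe.1 hbN)) i₀
    rcases hi₀ with h | h <;> rw [h] at this <;> omega
  have haS : a ∉ (↑(box d N) : Set (Site d))ᶜ := fun h =>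
    h (Finset.mem_coe.2 (box_mono d hLN ha))
  obtain ⟨c, c', hc, hc', hcc', hr⟩ := exists_exit_of_walk hH (↑(box d N) : Set (Site d))ᶜ W hbS haS
  have hcN : c ∉ box d N := fun h => hc (Finset.mem_coe.2 h)
  have hc'N : c' ∈ box d N := by
    by_contra h; exact hc' (fun h' => h (Finset.mem_coe.1 h'))
  obtain ⟨⟨i₁, hi₁⟩, hcN1⟩ := exists_abs_eq_of_adj_of_notMem_box hcN hc'N (hH hcc')
  -- the grid block of `c`
  set k := gridIdx L c with hkdef
  set g := gridPt L k with hgdef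
  have hk : k ∈ innerBoundary (zdGraph d) (box d ((N + 1 + L) / (2 * L + 1))) :=
    gridIdx_mem_innerBoundary hcN1 ⟨i₁, hi₁⟩
  have hcg : c ∈ sbox g L := mem_sbox_gridPt L c
  have hgi : ∀ i, |g i| ≤ (N : ℤ) + 1 + L := by
    intro i
    have h1 := gridPt_gridIdx_sub_le L c i
    rw [← hkdef, ← hgdef] at h1
    have h2 := (mem_box.1 hcN1) i
    push_cast at h2
    rw [abs_le]; constructor <;> linarith [h1.1, h1.2, h2.1, h2.2]
  -- `b` is outside `Λ_g(M)`
  have hbM : b ∉ sbox g M := by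
    intro h
    have h' := (mem_sbox_iff.1 h) i₀
    have hg := abs_le.1 (hgi i₀)
    have hMR : (M : ℤ) = R - (N + L + 2) := by rw [hM]; omega
    rcases hi₀ with h0 | h0 <;> rw [h0] at h' <;> [linarith [h'.2, hg.2]; linarith [h'.1, hg.1]]
  -- the walk from `c` to `b` outside `Λ(N)`, cut at its first exit from `Λ_g(M)`
  set H' := H ⊓ withinGraph (zdGraph d) (↑(box d N) : Set (Site d))ᶜ with hH'def
  have hH' : H' ≤ zdGraph d := inf_le_left.trans hH
  obtain ⟨W'⟩ := hr.symm
  obtain ⟨e, e', he, he', hee', hr'⟩ :=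
    exists_exit_of_walk hH' (sbox g M) W' (sbox_mono g hLM hcg) hbM
  refine Set.mem_iUnion₂.2 ⟨k, hk, h1, ?_⟩
  rw [mem_linked_iff]
  refine ⟨e, ?_, c, hcg, ?_⟩
  · -- `e` lies on the translated inner boundary of `Λ_g(M)`
    refine ⟨e - g, ?_, by simp [zdShiftIso_apply, hgdef]⟩
    rw [Finset.mem_coe, mem_innerBoundary_iff]
    have hbox : e - g ∈ box d M := by
      rw [mem_box]; intro i; simpa only [Pi.sub_apply] using (mem_sbox_iff.1 he) i
    refine ⟨hbox, e' - g, fun he2 => he' ?_, ?_⟩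
    · rw [mem_sbox_iff]; intro i; simpa only [Pi.sub_apply] using (mem_box.1 he2) i
    · have hG : (zdGraph d).Adj e e' := hH' hee'
      rw [← zdGraph_adj_shift_iff g, Site.shift_apply, Site.shift_apply, sub_add_cancel,
        sub_add_cancel]
      exact hG
  · -- the segment from `c` to `e` runs inside `Λ_g(M) ∖ Λ(N)`
    rw [mem_inConn_iff]
    refine (hr'.mono ?_).symm
    intro u v huv
    rw [SimpleGraph.inf_adj, SimpleGraph.inf_adj, SimpleGraph.inf_adj] at huv
    obtain ⟨⟨⟨hop, -⟩, hN⟩, hS⟩ := huv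
    rw [withinGraph_adj] at hN hS
    rw [SimpleGraph.inf_adj, withinGraph_adj]
    exact ⟨hop, hS.1, ⟨hS.2.1, hN.2.1⟩, ⟨hS.2.2, hN.2.2⟩⟩

/-- The outer piece has probability at most `u_p(L, M)` (monotonicity in the region, translation). -/
theorem real_exitPiece_le (p : unitInterval) (L M N : ℕ) (g : Site d) :
    (bondPercolation (zdGraph d) p).real
        (linked (sbox g M ∩ (↑(box d N))ᶜ)
          ((zdShiftIso g) '' ↑(innerBoundary (zdGraph d) (box d M))) (sbox g L)) ≤
      (bondPercolation (zdGraph d) p).real (boxCrossing d L M) := by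
  calc (bondPercolation (zdGraph d) p).real
        (linked (sbox g M ∩ (↑(box d N))ᶜ)
          ((zdShiftIso g) '' ↑(innerBoundary (zdGraph d) (box d M))) (sbox g L))
      ≤ (bondPercolation (zdGraph d) p).real
          (linked (sbox g M) ((zdShiftIso g) '' ↑(innerBoundary (zdGraph d) (box d M)))
            (sbox g L)) :=
        measureReal_mono (linked_mono_region Set.inter_subset_left _ _)
    _ = (bondPercolation (zdGraph d) p).real (boxCrossing d L M) := by
        rw [sbox, sbox, real_linked_image, boxCrossing_eq_linked]

/-- **One-step decoupling (all `p`, all `d`).** For `L ≤ N` and `N + 2L + 2 ≤ R`: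
`u_p(L, R) ≤ |∂ⁱⁿΛ(K)| · u_p(L, N) · u_p(L, R - (N+L+2))`, `K = ⌊(N+1+L)/(2L+1)⌋`. -/
theorem real_boxCrossing_le_card_mul (p : unitInterval) {L N R : ℕ} (hLN : L ≤ N)
    (hR : N + 2 * L + 2 ≤ R) :
    (bondPercolation (zdGraph d) p).real (boxCrossing d L R) ≤
      (innerBoundary (zdGraph d) (box d ((N + 1 + L) / (2 * L + 1)))).card *
        ((bondPercolation (zdGraph d) p).real (boxCrossing d L N) *
          (bondPercolation (zdGraph d) p).real (boxCrossing d L (R - (N + L + 2)))) := by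
  set M := R - (N + L + 2) with hM
  set G := innerBoundary (zdGraph d) (box d ((N + 1 + L) / (2 * L + 1))) with hG
  set μ := bondPercolation (zdGraph d) p with hμ
  -- each term: independence of the two pieces, then the bound on the outer piece
  have hterm : ∀ k ∈ G, μ.real (boxCrossing d L N ∩
      linked (sbox (gridPt L k) M ∩ (↑(box d N))ᶜ)
        ((zdShiftIso (gridPt L k)) '' ↑(innerBoundary (zdGraph d) (box d M)))
        (sbox (gridPt L k) L)) ≤
      μ.real (boxCrossing d L N) * μ.real (boxCrossing d L M) := by
    intro k _
    have hdisj : Disjoint (↑(box d N) : Set (Site d)) (sbox (gridPt L k) M ∩ (↑(box d N))ᶜ) :=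
      Set.disjoint_of_subset_right Set.inter_subset_right disjoint_compl_right
    have hA : DeterminedBy (boxCrossing d L N) (withinGraph (zdGraph d) (↑(box d N) : Set (Site d))).edgeSet := by
      rw [boxCrossing_eq_linked]; exact determinedBy_linked _ _ _
    rw [hμ, bondPercolation_real_inter_of_disjoint (zdGraph d) p (disjoint_edgeSet_withinGraph hdisj) hA
      (determinedBy_linked _ _ _) (measurableSet_boxCrossing L N) (measurableSet_linked _ _ _)]
    exact mul_le_mul_of_nonneg_left (real_exitPiece_le p L M N (gridPt L k)) measureReal_nonneg
  calc μ.real (boxCrossing d L R)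
      ≤ μ.real (⋃ k ∈ G, (boxCrossing d L N ∩
          linked (sbox (gridPt L k) M ∩ (↑(box d N))ᶜ)
            ((zdShiftIso (gridPt L k)) '' ↑(innerBoundary (zdGraph d) (box d M)))
            (sbox (gridPt L k) L))) :=
        measureReal_mono (boxCrossing_subset_biUnion_exit hLN hR) (measure_ne_top _ _)
    _ ≤ ∑ k ∈ G, μ.real (boxCrossing d L N ∩
          linked (sbox (gridPt L k) M ∩ (↑(box d N))ᶜ)
            ((zdShiftIso (gridPt L k)) '' ↑(innerBoundary (zdGraph d) (box d M)))
            (sbox (gridPt L k) L)) := measureReal_biUnion_finset_le _ _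
    _ ≤ ∑ k ∈ G, μ.real (boxCrossing d L N) * μ.real (boxCrossing d L M) := Finset.sum_le_sum hterm
    _ = G.card * (μ.real (boxCrossing d L N) * μ.real (boxCrossing d L M)) := by
        rw [Finset.sum_const, nsmul_eq_mul]

/-- The same with the explicit count `2d (4N/L)^{d-1}` (`1 ≤ L ≤ N`, `N + 2L + 2 ≤ R`). -/
theorem real_boxCrossing_le_mul (p : unitInterval) {L N R : ℕ} (hL : 1 ≤ L) (hLN : L ≤ N)
    (hR : N + 2 * L + 2 ≤ R) :
    (bondPercolation (zdGraph d) p).real (boxCrossing d L R) ≤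
      2 * d * (4 * (N : ℝ) / L) ^ (d - 1) *
        ((bondPercolation (zdGraph d) p).real (boxCrossing d L N) *
          (bondPercolation (zdGraph d) p).real (boxCrossing d L (R - (N + L + 2)))) :=
  (real_boxCrossing_le_card_mul p hLN hR).trans
    (mul_le_mul_of_nonneg_right (card_innerBoundary_gridBox_le hL hLN)
      (mul_nonneg measureReal_nonneg measureReal_nonneg))

end Rsw3

end Summit.CriticalPhenomena.PercolationContinuityZ3.Theorems

end
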